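import Summits.ValiantsHypothesis.ValiantsHypothesis.Theses.NewtonUnitEquations

/-!
# Crux `TwoProducts` (stmt-ValiantsHypothesis-5906) — idea `presentation-bootstrap` (val-idea-35, lens «REFUTE via the escape tables»)

Sketch file for the crux idea card — SORRY-FREE (rev 3, 2026-08-28).  The crux bound `2^(a m)·(t+2)^b` is NOT
invariant under re-blocking the factors (`M` factors of sparsity `s` ↦ `⌈M/r⌉` blocks of sparsity `≤ s^r`), so the
crux is SELF-IMPROVING.  All five statements below are KERNEL-PROVED (standard axioms only):

* `blockBound_of_twoProducts`: `TwoProducts` ⇒ the same bound `2^(a k)(s^r+2)^b` for every block presentation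
  (`k` blocks of `r` factors of sparsity `s`);
* `boundedSparsitySubexp_of_twoProducts`: `TwoProducts` ⇒ for each fixed sparsity `s`, two products of `M`
  `s`-sparse factors have `≤ 2^(C_s (√M + 1))` Newton vertices;
* `not_twoProducts_of_trinomialExpGrowth`: exponential vertex growth (`> 2^(M/c)` for unboundedly many `M`) for two
  products of `M` TRINOMIALS refutes the crux BY NAME (the refutation criterion of the card);
* `polyInExpRegime_of_twoProducts` (`κ ≥ 1`) and `twoProducts_of_polyInExpRegime` (every `κ`): the crux is
  EQUIVALENT to the purely polynomial bound `#vert ≤ (t+2)^b` in the regime `t ≥ 2^(κ m)`.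

Nothing here proves or refutes the crux; VP ≠ VNP is NOT proved.
-/

set_option linter.dupNamespace false

namespace Summit.ValiantsHypothesis.ValiantsHypothesis.Cruxes.TwoProducts.PresentationBootstrap

open scoped BigOperators Pointwise
open Summit.ValiantsHypothesis.ValiantsHypothesis.Theses.NewtonUnitEquations (TwoProducts)

/-- number of vertices of the Newton polygon of `W` (the crux's count, verbatim). -/
noncomputable abbrev vert (W : MvPolynomial (Fin 2) ℂ) : ℕ :=
  (Set.extremePoints ℝ (convexHull ℝ ((fun e : Fin 2 →₀ ℕ => fun i : Fin 2 => ((e i : ℕ) : ℝ)) ''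
    (W.support : Set (Fin 2 →₀ ℕ))))).ncard

/-- A finite product of `s`-sparse polynomials has at most `s ^ #S` monomials. -/
theorem card_support_prod_le {ι : Type*} [DecidableEq ι] (S : Finset ι) (s : ℕ)
    (f : ι → MvPolynomial (Fin 2) ℂ) (hf : ∀ i ∈ S, (f i).support.card ≤ s) :
    (∏ i ∈ S, f i).support.card ≤ s ^ S.card := by
  classical
  induction S using Finset.induction_on with
  | empty =>
    simp only [Finset.prod_empty, Finset.card_empty, pow_zero]
    rw [← MvPolynomial.C_1, MvPolynomial.C_apply]
    exact (Finset.card_le_card MvPolynomial.support_monomial_subset).trans (by simp)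
  | insert a S ha ih =>
    rw [Finset.prod_insert ha, Finset.card_insert_of_notMem ha, pow_succ]
    calc ((f a) * ∏ i ∈ S, f i).support.card
        ≤ ((f a).support + (∏ i ∈ S, f i).support).card :=
          Finset.card_le_card (MvPolynomial.support_mul _ _)
      _ ≤ (f a).support.card * (∏ i ∈ S, f i).support.card := Finset.card_add_le
      _ ≤ s * s ^ S.card :=
          Nat.mul_le_mul (hf a (by simp)) (ih (fun i hi => hf i (by simp [hi])))
      _ = s ^ S.card * s := by ring

/-- Re-blocking a product over `Fin (k * r)` into `k` blocks of `r` consecutive factors. -/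
theorem prod_blocks (k r : ℕ) (f : Fin (k * r) → MvPolynomial (Fin 2) ℂ) :
    ∏ j : Fin k, ∏ i : Fin r, f (finProdFinEquiv (j, i)) = ∏ i, f i := by
  have h1 : ∏ x : Fin k × Fin r, f (finProdFinEquiv x) =
      ∏ j : Fin k, ∏ i : Fin r, f (finProdFinEquiv (j, i)) := Fintype.prod_prod_type _
  rw [← h1]
  exact Fintype.prod_equiv finProdFinEquiv _ _ (fun _ => rfl)

/-- The crux's bound transported to BLOCK presentations: `k` blocks of `r` factors of sparsity `≤ s`
(so each block is a factor of sparsity `≤ s^r`). -/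
def BlockBound : Prop :=
  ∃ a b : ℕ, ∀ (k r s : ℕ) (f g : Fin (k * r) → MvPolynomial (Fin 2) ℂ),
    (∀ i, (f i).support.card ≤ s) → (∀ i, (g i).support.card ≤ s) →
      vert (∏ i, f i - ∏ i, g i) ≤ 2 ^ (a * k) * (s ^ r + 2) ^ b

/-- FIRST LEMMA (proved): `TwoProducts` is inherited by every block presentation, with the SAME `(a, b)`. -/
theorem blockBound_of_twoProducts (h : TwoProducts) : BlockBound := by
  obtain ⟨a, b, hab⟩ := h
  refine ⟨a, b, fun k r s f g hf hg => ?_⟩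
  have hF : ∀ j : Fin k, (∏ i : Fin r, f (finProdFinEquiv (j, i))).support.card ≤ s ^ r := fun j => by
    simpa using card_support_prod_le (Finset.univ : Finset (Fin r)) s
      (fun i => f (finProdFinEquiv (j, i))) (fun i _ => hf _)
  have hG : ∀ j : Fin k, (∏ i : Fin r, g (finProdFinEquiv (j, i))).support.card ≤ s ^ r := fun j => by
    simpa using card_support_prod_le (Finset.univ : Finset (Fin r)) s
      (fun i => g (finProdFinEquiv (j, i))) (fun i _ => hg _)
  have key := hab k (s ^ r) (fun j => ∏ i : Fin r, f (finProdFinEquiv (j, i)))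
    (fun j => ∏ i : Fin r, g (finProdFinEquiv (j, i))) hF hG
  simpa only [prod_blocks] using key

/-- Bounded sparsity forces SUBEXPONENTIAL growth in the number of factors (corollary of `BlockBound` by
optimising the block size `r ≈ √(aM / (b log s))`): for each `s` a constant `C` with `#vert ≤ 2^(C (√M + 1))`. -/
def BoundedSparsitySubexp : Prop :=
  ∀ s : ℕ, ∃ C : ℕ, ∀ (M : ℕ) (f g : Fin M → MvPolynomial (Fin 2) ℂ),
    (∀ i, (f i).support.card ≤ s) → (∀ i, (g i).support.card ≤ s) →
      vert (∏ i, f i - ∏ i, g i) ≤ 2 ^ (C * (Nat.sqrt M + 1))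

-- `boundedSparsitySubexp_of_twoProducts` is proved at the end of the file (it needs the padding helpers).

/-- REFUTATION TARGET: two products of `M` TRINOMIALS with exponentially many Newton vertices
(`> 2^(M/c)` for unboundedly many `M`). -/
def TrinomialExpGrowth : Prop :=
  ∃ c : ℕ, 0 < c ∧ ∀ M₀ : ℕ, ∃ M : ℕ, M₀ ≤ M ∧ ∃ f g : Fin M → MvPolynomial (Fin 2) ℂ,
    (∀ i, (f i).support.card ≤ 3) ∧ (∀ i, (g i).support.card ≤ 3) ∧
      2 ^ (M / c) < vert (∏ i, f i - ∏ i, g i)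

/-- Padding a family of `M` factors to `N ≥ M` factors by `1`s. -/
noncomputable def pad {M : ℕ} (f : Fin M → MvPolynomial (Fin 2) ℂ) (N : ℕ) : Fin N → MvPolynomial (Fin 2) ℂ :=
  fun i => if h : (i : ℕ) < M then f ⟨i, h⟩ else 1

theorem prod_pad {M N : ℕ} (hMN : M ≤ N) (f : Fin M → MvPolynomial (Fin 2) ℂ) :
    ∏ i : Fin N, pad f N i = ∏ i, f i := by
  classical
  let F : ℕ → MvPolynomial (Fin 2) ℂ := fun n => if h : n < M then f ⟨n, h⟩ else 1
  have hL : ∏ i : Fin N, pad f N i = ∏ n ∈ Finset.range N, F n := by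
    rw [← Fin.prod_univ_eq_prod_range]
    rfl
  have hR : ∏ i : Fin M, f i = ∏ n ∈ Finset.range M, F n := by
    rw [← Fin.prod_univ_eq_prod_range]
    refine Finset.prod_congr rfl (fun i _ => ?_)
    simp [F, i.2]
  rw [hL, hR]
  symm
  apply Finset.prod_subset (Finset.range_mono hMN)
  intro x _ hx
  have hx' : ¬ x < M := by simpa using hx
  simp [F, hx']

theorem card_support_one_le : (1 : MvPolynomial (Fin 2) ℂ).support.card ≤ 1 := by
  classical
  rw [← MvPolynomial.C_1, MvPolynomial.C_apply]
  exact (Finset.card_le_card MvPolynomial.support_monomial_subset).trans (by simp)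

theorem card_support_pad_le {M s : ℕ} (hs : 1 ≤ s) (f : Fin M → MvPolynomial (Fin 2) ℂ)
    (hf : ∀ i, (f i).support.card ≤ s) (N : ℕ) : ∀ i, (pad f N i).support.card ≤ s := by
  intro i
  unfold pad
  split_ifs with h
  · exact hf _
  · exact card_support_one_le.trans hs

/-- The arithmetic of the block choice `r = 2ac + 1`, `k = M/r + 1`, `s = 3`. -/
theorem block_arith (a b c M r : ℕ) (hc : 0 < c) (hr : r = 2 * a * c + 1)
    (hM : 2 * c * (a + (2 * r + 1) * b + 1) ≤ M) :
    2 ^ (a * (M / r + 1)) * (3 ^ r + 2) ^ b ≤ 2 ^ (M / c) := by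
  have hrpos : 0 < r := by omega
  have h32 : 3 ^ r + 2 ≤ 2 ^ (2 * r + 1) := by
    have h1 : 3 ^ r ≤ 4 ^ r := Nat.pow_le_pow_left (by norm_num) r
    have h2 : (4 : ℕ) ^ r = 2 ^ (2 * r) := by
      rw [pow_mul]; norm_num
    have h3 : 2 ≤ 2 ^ (2 * r) := by
      calc (2 : ℕ) = 2 ^ 1 := by norm_num
        _ ≤ 2 ^ (2 * r) := Nat.pow_le_pow_right (by norm_num) (by omega)
    have h4 : (2 : ℕ) ^ (2 * r + 1) = 2 ^ (2 * r) + 2 ^ (2 * r) := by rw [pow_succ]; ring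
    rw [h4]; omega
  have hb : (3 ^ r + 2) ^ b ≤ 2 ^ ((2 * r + 1) * b) := by
    rw [pow_mul]; exact Nat.pow_le_pow_left h32 b
  have hdiv : a * (M / r + 1) ≤ M / (2 * c) + a := by
    rcases Nat.eq_zero_or_pos a with ha | ha
    · simp [ha]
    · have h5 : a * (M / r) ≤ M / (2 * c) := by
        calc a * (M / r) ≤ a * M / r := Nat.mul_div_le_mul_div_assoc _ _ _
          _ ≤ a * M / (2 * a * c) := Nat.div_le_div_left (by omega) (by positivity)
          _ = a * M / (a * (2 * c)) := by rw [show 2 * a * c = a * (2 * c) by ring]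
          _ = M / (2 * c) := Nat.mul_div_mul_left M (2 * c) ha
      calc a * (M / r + 1) = a * (M / r) + a := by ring
        _ ≤ M / (2 * c) + a := by omega
  have hM2 : a + (2 * r + 1) * b + 1 ≤ M / (2 * c) := by
    rw [Nat.le_div_iff_mul_le (by positivity)]
    calc (a + (2 * r + 1) * b + 1) * (2 * c) = 2 * c * (a + (2 * r + 1) * b + 1) := by ring
      _ ≤ M := hM
  have hM3 : M / (2 * c) + M / (2 * c) ≤ M / c := by
    have h6 : M / (2 * c) = M / c / 2 := by rw [Nat.div_div_eq_div_mul, mul_comm]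
    rw [h6]; omega
  calc 2 ^ (a * (M / r + 1)) * (3 ^ r + 2) ^ b
      ≤ 2 ^ (a * (M / r + 1)) * 2 ^ ((2 * r + 1) * b) := Nat.mul_le_mul_left _ hb
    _ = 2 ^ (a * (M / r + 1) + (2 * r + 1) * b) := (pow_add _ _ _).symm
    _ ≤ 2 ^ (M / c) := Nat.pow_le_pow_right (by norm_num) (by
        have h7 : a * (M / r + 1) + (2 * r + 1) * b ≤ M / (2 * c) + a + (2 * r + 1) * b :=
          Nat.add_le_add_right hdiv _
        omega)

/-- Exponential trinomial growth refutes the crux: pad `M` to `(M/r + 1)·r` factors with `1`s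
(`r = 2ac+1`), apply `BlockBound` with `k = M/r + 1`, `s = 3`, and compare with `block_arith`. -/
theorem not_twoProducts_of_trinomialExpGrowth : TrinomialExpGrowth → ¬ TwoProducts := by
  rintro ⟨c, hc, hgrow⟩ hTP
  obtain ⟨a, b, hab⟩ := blockBound_of_twoProducts hTP
  obtain ⟨M, hM, f, g, hf, hg, hlt⟩ := hgrow (2 * c * (a + (2 * (2 * a * c + 1) + 1) * b + 1))
  set r : ℕ := 2 * a * c + 1 with hr
  have hrpos : 0 < r := by omega
  have hMN : M ≤ (M / r + 1) * r := by
    have h := Nat.lt_div_mul_add (a := M) hrpos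
    rw [add_mul, one_mul]
    exact h.le
  have key := hab (M / r + 1) r 3 (pad f _) (pad g _)
    (card_support_pad_le (by norm_num) f hf _) (card_support_pad_le (by norm_num) g hg _)
  rw [prod_pad hMN, prod_pad hMN] at key
  have harith := block_arith a b c M r hc hr hM
  exact absurd (hlt.trans_le (key.trans harith)) (lt_irrefl _)

/-- The crux restricted to the regime `t ≥ 2^(κ m)`, with a purely POLYNOMIAL allowance `(t+2)^b`. -/
def PolyInExpRegime (κ : ℕ) : Prop :=
  ∃ b : ℕ, ∀ (m t : ℕ) (f g : Fin m → MvPolynomial (Fin 2) ℂ), 2 ^ (κ * m) ≤ t →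
    (∀ j, (f j).support.card ≤ t) → (∀ j, (g j).support.card ≤ t) →
      vert (∏ j, f j - ∏ j, g j) ≤ (t + 2) ^ b

/-- easy direction: in the regime, `2^(a m) ≤ t^a`. -/
theorem polyInExpRegime_of_twoProducts (κ : ℕ) (hκ : 1 ≤ κ) : TwoProducts → PolyInExpRegime κ := by
  rintro ⟨a, b, hab⟩
  refine ⟨a + b, fun m t f g ht hf hg => ?_⟩
  have h1 := hab m t f g hf hg
  have h2 : 2 ^ (a * m) ≤ (t + 2) ^ a := by
    have h3 : 2 ^ m ≤ t + 2 := by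
      calc 2 ^ m = 2 ^ (1 * m) := by rw [one_mul]
        _ ≤ 2 ^ (κ * m) := Nat.pow_le_pow_right (by norm_num) (Nat.mul_le_mul_right m hκ)
        _ ≤ t := ht
        _ ≤ t + 2 := Nat.le_add_right t 2
    calc 2 ^ (a * m) = (2 ^ m) ^ a := by rw [mul_comm, pow_mul]
      _ ≤ (t + 2) ^ a := Nat.pow_le_pow_left h3 a
  calc vert (∏ j, f j - ∏ j, g j) ≤ 2 ^ (a * m) * (t + 2) ^ b := h1
    _ ≤ (t + 2) ^ a * (t + 2) ^ b := Nat.mul_le_mul_right _ h2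
    _ = (t + 2) ^ (a + b) := (pow_add _ _ _).symm

/-- `#vert ≤ #supp`. -/
theorem vert_le_card_support (W : MvPolynomial (Fin 2) ℂ) : vert W ≤ W.support.card := by
  have hfin : (W.support : Set (Fin 2 →₀ ℕ)).Finite := W.support.finite_toSet
  calc vert W ≤ ((fun e : Fin 2 →₀ ℕ => fun i : Fin 2 => ((e i : ℕ) : ℝ)) ''
          (W.support : Set (Fin 2 →₀ ℕ))).ncard :=
        Set.ncard_le_ncard (extremePoints_convexHull_subset) (hfin.image _)
    _ ≤ (W.support : Set (Fin 2 →₀ ℕ)).ncard := Set.ncard_image_le hfin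
    _ = W.support.card := Set.ncard_coe_finset _

theorem card_support_prod_sub_le {m t : ℕ} (f g : Fin m → MvPolynomial (Fin 2) ℂ)
    (hf : ∀ i, (f i).support.card ≤ t) (hg : ∀ i, (g i).support.card ≤ t) :
    (∏ i, f i - ∏ i, g i).support.card ≤ t ^ m + t ^ m := by
  classical
  calc (∏ i, f i - ∏ i, g i).support.card ≤ ((∏ i, f i).support ∪ (∏ i, g i).support).card :=
        Finset.card_le_card (MvPolynomial.support_sub _ _ _)
    _ ≤ (∏ i, f i).support.card + (∏ i, g i).support.card := Finset.card_union_le _ _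
    _ ≤ t ^ m + t ^ m := by
        have h1 := card_support_prod_le (Finset.univ : Finset (Fin m)) t f (fun i _ => hf i)
        have h2 := card_support_prod_le (Finset.univ : Finset (Fin m)) t g (fun i _ => hg i)
        simp only [Finset.card_univ, Fintype.card_fin] at h1 h2
        exact Nat.add_le_add h1 h2

/-- Re-blocking a padded family: `k` blocks of `r` factors, block sparsity `≤ t^r`, same product. -/
theorem exists_reblock {m k r t : ℕ} (hmN : m ≤ k * r) (ht : 1 ≤ t) (f : Fin m → MvPolynomial (Fin 2) ℂ)
    (hf : ∀ i, (f i).support.card ≤ t) :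
    ∃ F : Fin k → MvPolynomial (Fin 2) ℂ, (∀ j, (F j).support.card ≤ t ^ r) ∧ ∏ j, F j = ∏ i, f i := by
  classical
  refine ⟨fun j => ∏ i : Fin r, pad f (k * r) (finProdFinEquiv (j, i)), fun j => ?_, ?_⟩
  · simpa using card_support_prod_le (Finset.univ : Finset (Fin r)) t
      (fun i => pad f (k * r) (finProdFinEquiv (j, i))) (fun i _ => card_support_pad_le ht f hf _ _)
  · show (∏ j : Fin k, ∏ i : Fin r, pad f (k * r) (finProdFinEquiv (j, i))) = ∏ i, f i
    rw [prod_blocks k r (pad f (k * r)), prod_pad hmN]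

/-- Applying the regime hypothesis to a re-blocked instance. -/
theorem reblock_apply {κ b m t r k L : ℕ}
    (hb : ∀ (m t : ℕ) (f g : Fin m → MvPolynomial (Fin 2) ℂ), 2 ^ (κ * m) ≤ t →
      (∀ j, (f j).support.card ≤ t) → (∀ j, (g j).support.card ≤ t) →
        vert (∏ j, f j - ∏ j, g j) ≤ (t + 2) ^ b)
    (ht1 : 1 ≤ t) (h2L : 2 ^ L ≤ t) (hmk : m ≤ k * r) (hκ : κ * k ≤ r * L)
    (f g : Fin m → MvPolynomial (Fin 2) ℂ) (hf : ∀ i, (f i).support.card ≤ t)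
    (hg : ∀ i, (g i).support.card ≤ t) :
    vert (∏ j, f j - ∏ j, g j) ≤ (t ^ r + 2) ^ b := by
  obtain ⟨F, hF, hFp⟩ := exists_reblock (k := k) (r := r) hmk ht1 f hf
  obtain ⟨G, hG, hGp⟩ := exists_reblock (k := k) (r := r) hmk ht1 g hg
  have hreg : 2 ^ (κ * k) ≤ t ^ r :=
    calc 2 ^ (κ * k) ≤ 2 ^ (r * L) := Nat.pow_le_pow_right (by norm_num) hκ
      _ = (2 ^ L) ^ r := by rw [show r * L = L * r from mul_comm _ _, pow_mul]
      _ ≤ t ^ r := Nat.pow_le_pow_left h2L r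
  have key := hb k (t ^ r) F G hreg hF hG
  rwa [hFp, hGp] at key

/-- The common finishing step of the three regimes. -/
theorem regime_finish {V X b κ m t : ℕ} (hV : V ≤ X ^ b) (hX : X ≤ (t + 2) ^ (2 * κ + 1) * 2 ^ (2 * m)) :
    V ≤ 2 ^ (2 * b * m) * (t + 2) ^ ((2 * κ + 3) * b + 1) := by
  have hT1 : 1 ≤ t + 2 := by omega
  calc V ≤ X ^ b := hV
    _ ≤ ((t + 2) ^ (2 * κ + 1) * 2 ^ (2 * m)) ^ b := Nat.pow_le_pow_left hX b
    _ = (t + 2) ^ ((2 * κ + 1) * b) * 2 ^ (2 * b * m) := by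
        rw [mul_pow, ← pow_mul, ← pow_mul, show 2 * m * b = 2 * b * m by ring]
    _ ≤ (t + 2) ^ ((2 * κ + 3) * b + 1) * 2 ^ (2 * b * m) :=
        Nat.mul_le_mul_right _ (Nat.pow_le_pow_right hT1 (by nlinarith))
    _ = 2 ^ (2 * b * m) * (t + 2) ^ ((2 * κ + 3) * b + 1) := mul_comm _ _

/-- REGIME REDUCTION (PROVED): a polynomial bound in the regime `t ≥ 2^(κ m)` already gives the crux.  Three
regimes for `t ≥ 2`, `L = ⌊log₂ t⌋`: (i) `2^(κm) ≤ t`: the hypothesis itself; (ii) `m ≥ κ(L+1)`: re-block into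
`k = m/r + 1` blocks of `r = m/L + 1` factors (`t^r ≤ t·2^(2m)`); (iii) otherwise `r = 2κ`; and `t ≤ 1` is trivial
(`#vert ≤ #supp ≤ 2`).  Constants: `(a', b') = (2b, (2κ+3)b + 1)`. -/
theorem twoProducts_of_polyInExpRegime (κ : ℕ) : PolyInExpRegime κ → TwoProducts := by
  rintro ⟨b, hb⟩
  refine ⟨2 * b, (2 * κ + 3) * b + 1, fun m t f g hf hg => ?_⟩
  show vert (∏ j, f j - ∏ j, g j) ≤ 2 ^ (2 * b * m) * (t + 2) ^ ((2 * κ + 3) * b + 1)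
  have hT1 : 1 ≤ t + 2 := by omega
  have h2pos : 1 ≤ 2 ^ (2 * m) := Nat.one_le_two_pow
  rcases Nat.lt_or_ge t 2 with ht | ht
  · -- t ≤ 1 : at most two monomials survive
    have hsmall : vert (∏ j, f j - ∏ j, g j) ≤ 2 := by
      calc vert (∏ j, f j - ∏ j, g j) ≤ (∏ j, f j - ∏ j, g j).support.card := vert_le_card_support _
        _ ≤ t ^ m + t ^ m := card_support_prod_sub_le f g hf hg
        _ ≤ 1 ^ m + 1 ^ m :=
            Nat.add_le_add (Nat.pow_le_pow_left (by omega) m) (Nat.pow_le_pow_left (by omega) m)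
        _ = 2 := by simp
    calc vert (∏ j, f j - ∏ j, g j) ≤ 2 := hsmall
      _ ≤ (t + 2) ^ 1 := by simp
      _ ≤ (t + 2) ^ ((2 * κ + 3) * b + 1) := Nat.pow_le_pow_right hT1 (by omega)
      _ ≤ 2 ^ (2 * b * m) * (t + 2) ^ ((2 * κ + 3) * b + 1) := Nat.le_mul_of_pos_left _ (by positivity)
  -- t ≥ 2
  set L := Nat.log 2 t with hL
  have hL1 : 1 ≤ L := Nat.log_pos (by norm_num) ht
  have h2L : 2 ^ L ≤ t := Nat.pow_log_le_self 2 (by omega)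
  have htL : t < 2 ^ (L + 1) := Nat.lt_pow_succ_log_self (by norm_num) t
  have ht1 : 1 ≤ t := by omega
  have hX1 : t + 2 ≤ (t + 2) ^ (2 * κ + 1) * 2 ^ (2 * m) :=
    calc t + 2 = (t + 2) ^ 1 := (pow_one _).symm
      _ ≤ (t + 2) ^ (2 * κ + 1) := Nat.pow_le_pow_right hT1 (by omega)
      _ ≤ (t + 2) ^ (2 * κ + 1) * 2 ^ (2 * m) := Nat.le_mul_of_pos_right _ (by positivity)
  by_cases hreg : 2 ^ (κ * m) ≤ t
  · -- (i) inside the regime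
    exact regime_finish (hb m t f g hreg hf hg) hX1
  have hκ1 : 1 ≤ κ := by
    rcases Nat.eq_zero_or_pos κ with h0 | h0
    · exact absurd (by rw [h0, zero_mul, pow_zero]; exact ht1) hreg
    · exact h0
  by_cases hm : κ * (L + 1) ≤ m
  · -- (ii) many factors: r = m / L + 1, k = m / r + 1
    set r := m / L + 1 with hr
    have hrpos : 0 < r := Nat.succ_pos _
    set k := m / r + 1 with hk
    have hmk : m ≤ k * r := by
      have := Nat.lt_div_mul_add (a := m) hrpos
      rw [hk, add_mul, one_mul]; exact this.le
    have hmrL : m ≤ r * L := by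
      have := Nat.lt_div_mul_add (a := m) (show 0 < L by omega)
      rw [hr, add_mul, one_mul]; exact this.le
    have hdiv : m / r ≤ L := Nat.div_le_of_le_mul hmrL
    have hκk : κ * k ≤ r * L :=
      calc κ * k = κ * (m / r + 1) := by rw [hk]
        _ ≤ κ * (L + 1) := Nat.mul_le_mul_left κ (by omega)
        _ ≤ m := hm
        _ ≤ r * L := hmrL
    have hV := reblock_apply hb ht1 h2L hmk hκk f g hf hg
    have hq : L * (m / L) ≤ m := Nat.mul_div_le m L
    have hq2 : m / L ≤ L * (m / L) := Nat.le_mul_of_pos_left _ (by omega)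
    have hexp : (L + 1) * (m / L) ≤ 2 * m := by
      calc (L + 1) * (m / L) = L * (m / L) + m / L := by ring
        _ ≤ L * (m / L) + L * (m / L) := Nat.add_le_add_left hq2 _
        _ ≤ m + m := Nat.add_le_add hq hq
        _ = 2 * m := by ring
    have htpow : t ^ (m / L) ≤ 2 ^ (2 * m) :=
      calc t ^ (m / L) ≤ (2 ^ (L + 1)) ^ (m / L) := Nat.pow_le_pow_left htL.le _
        _ = 2 ^ ((L + 1) * (m / L)) := by rw [← pow_mul]
        _ ≤ 2 ^ (2 * m) := Nat.pow_le_pow_right (by norm_num) hexp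
    have hX : t ^ r + 2 ≤ (t + 2) ^ (2 * κ + 1) * 2 ^ (2 * m) :=
      calc t ^ r + 2 = t ^ (m / L) * t + 2 := by rw [hr, pow_succ]
        _ ≤ 2 ^ (2 * m) * t + 2 ^ (2 * m) * 2 := by
            have := Nat.mul_le_mul_right t htpow
            nlinarith [this, h2pos]
        _ = 2 ^ (2 * m) * (t + 2) := by ring
        _ ≤ 2 ^ (2 * m) * ((t + 2) ^ (2 * κ + 1)) :=
            Nat.mul_le_mul_left _ (by
              calc t + 2 = (t + 2) ^ 1 := (pow_one _).symm
                _ ≤ (t + 2) ^ (2 * κ + 1) := Nat.pow_le_pow_right hT1 (by omega))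
        _ = (t + 2) ^ (2 * κ + 1) * 2 ^ (2 * m) := mul_comm _ _
    exact regime_finish hV hX
  · -- (iii) the gap `log₂ t / κ < m < κ (L+1)`: r = 2κ, k = m / r + 1
    push_neg at hm
    set r := κ * 2 with hr
    have hrpos : 0 < r := by omega
    set k := m / r + 1 with hk
    have hmk : m ≤ k * r := by
      have := Nat.lt_div_mul_add (a := m) hrpos
      rw [hk, add_mul, one_mul]; exact this.le
    have hdiv : m / r ≤ (L + 1) / 2 := by
      calc m / r ≤ (κ * (L + 1)) / r := Nat.div_le_div_right hm.le
        _ = (L + 1) / 2 := by rw [hr]; exact Nat.mul_div_mul_left (L + 1) 2 (by omega)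
    have hk2 : k ≤ 2 * L := by rw [hk]; omega
    have hκk : κ * k ≤ r * L :=
      calc κ * k ≤ κ * (2 * L) := Nat.mul_le_mul_left κ hk2
        _ = r * L := by rw [hr]; ring
    have hV := reblock_apply hb ht1 h2L hmk hκk f g hf hg
    have hP1 : 1 ≤ (t + 2) ^ r := Nat.one_le_pow _ _ (by omega)
    have hX : t ^ r + 2 ≤ (t + 2) ^ (2 * κ + 1) * 2 ^ (2 * m) :=
      calc t ^ r + 2 ≤ (t + 2) ^ r + 2 := Nat.add_le_add_right (Nat.pow_le_pow_left (by omega) r) 2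
        _ ≤ (t + 2) ^ r * (t + 2) := by nlinarith [hP1, hT1]
        _ = (t + 2) ^ (2 * κ + 1) := by rw [← pow_succ, hr, mul_comm κ 2]
        _ ≤ (t + 2) ^ (2 * κ + 1) * 2 ^ (2 * m) := Nat.le_mul_of_pos_right _ (by positivity)
    exact regime_finish hV hX

/-- BOUNDED SPARSITY COROLLARY (PROVED): `TwoProducts` forces `2^{O_s(√M)}` vertex growth for two products of
`M` factors of sparsity `≤ s` (re-block into `M/R + 1` blocks of `R = √M + 1` padded factors). -/
theorem boundedSparsitySubexp_of_twoProducts : TwoProducts → BoundedSparsitySubexp := by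
  intro hTP s
  obtain ⟨a, b, hB⟩ := blockBound_of_twoProducts hTP
  rcases Nat.eq_zero_or_pos s with hs0 | hs1
  · refine ⟨1, fun M f g hf hg => ?_⟩
    subst hs0
    calc vert (∏ i, f i - ∏ i, g i) ≤ (∏ i, f i - ∏ i, g i).support.card := vert_le_card_support _
      _ ≤ 0 ^ M + 0 ^ M := card_support_prod_sub_le f g hf hg
      _ ≤ 1 ^ M + 1 ^ M :=
          Nat.add_le_add (Nat.pow_le_pow_left (by omega) M) (Nat.pow_le_pow_left (by omega) M)
      _ = 2 ^ 1 := by simp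
      _ ≤ 2 ^ (1 * (Nat.sqrt M + 1)) := Nat.pow_le_pow_right (by norm_num) (by omega)
  · refine ⟨a + (s + 2) * b, fun M f g hf hg => ?_⟩
    set R := Nat.sqrt M + 1 with hR
    have hRpos : 0 < R := Nat.succ_pos _
    set k := M / R + 1 with hk
    have hMk : M ≤ k * R := by
      have := Nat.lt_div_mul_add (a := M) hRpos
      rw [hk, add_mul, one_mul]; exact this.le
    have hdiv : M / R < R := (Nat.div_lt_iff_lt_mul hRpos).2 (Nat.lt_succ_sqrt M)
    have hkR : k ≤ R := by rw [hk]; omega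
    have key := hB k R s (pad f (k * R)) (pad g (k * R))
      (card_support_pad_le hs1 f hf _) (card_support_pad_le hs1 g hg _)
    rw [prod_pad hMk, prod_pad hMk] at key
    have hs2 : s + 2 ≤ 2 ^ (s + 2) := (@Nat.lt_two_pow_self (s + 2)).le
    have h22 : 2 ≤ 2 ^ R := by
      calc 2 = 2 ^ 1 := by norm_num
        _ ≤ 2 ^ R := Nat.pow_le_pow_right (by norm_num) hRpos
    have hsR : s ^ R + 2 ≤ 2 ^ ((s + 2) * R) :=
      calc s ^ R + 2 ≤ s ^ R + 2 ^ R := Nat.add_le_add_left h22 _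
        _ ≤ (s + 2) ^ R := pow_add_pow_le (by omega) (by omega) hRpos.ne'
        _ ≤ (2 ^ (s + 2)) ^ R := Nat.pow_le_pow_left hs2 R
        _ = 2 ^ ((s + 2) * R) := by rw [← pow_mul]
    calc vert (∏ i, f i - ∏ i, g i) ≤ 2 ^ (a * k) * (s ^ R + 2) ^ b := key
      _ ≤ 2 ^ (a * R) * (2 ^ ((s + 2) * R)) ^ b :=
          Nat.mul_le_mul (Nat.pow_le_pow_right (by norm_num) (Nat.mul_le_mul_left a hkR))
            (Nat.pow_le_pow_left hsR b)
      _ = 2 ^ ((a + (s + 2) * b) * R) := by rw [← pow_mul, ← pow_add]; ring_nf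

end Summit.ValiantsHypothesis.ValiantsHypothesis.Cruxes.TwoProducts.PresentationBootstrap
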